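import Literature.Analysis.ODE.CodeListMeanValueExtension
import Literature.Analysis.ODE.VariationalEnclosureCertificate
import HarnessLib

/-!
# A kernel-checkable `C¹` enclosure step certificate for elementary vector fields

Trunk T-ANA (Analysis/ODE); namespace `Literature.Analysis.ODE`.

`VariationalEnclosureCertificate.lean` certifies one `C¹` step — the state enclosure AND the
enclosure of the derivative of the flow `V(t) = D_xφ(t, x)`, solution of the variational equation
`V' = Df(y) V`, `V(0) = Id` — for POLYNOMIAL fields, whose flow Taylor coefficient maps
`Φⱼ = (1/j!) L_f^j Id` and their Jacobians `DΦⱼ` are polynomials enclosed by natural interval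
extension.  `ElementaryFieldEnclosureCertificate.lean` certifies the STATE step for elementary
(code-list) fields `f` built from `+ − × ^`, rational constants and scalars, `exp`, `log`, `sin`,
`cos`, `⁻¹`, `/`, `√`, and `CodeListMeanValueExtension.lean` supplies, line by line, the derived
code list `pderiv k e` of a partial derivative (Moore 1979 (4.21)) with the theorem
`f'(x) e_k = (pderiv k f)(x)` on the natural domain and the natural interval extension `evalBox`.

This file closes the remaining gap — the `C¹` step for elementary fields (Zgliczyński's
`C¹`-Lohner step; Walawska–Wilczak 2016 §2.1, "the two high-order enclosures are checked
simultaneously"):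

* §1 `FExpr.taylorExpr F j i` — the code list of the `i`-th component of the `j`-th flow Taylor
  coefficient map, generated symbolically by the Lie–Taylor recursion
  `Φ_{j+1} = (1/(j+1)) ∑_l f_l ∂_l Φⱼ` (Moore 1979 (3.15); Hairer–Lubich–Wanner III (5.6)) from
  the derived code lists of §1 of `CodeListMeanValueExtension`; `eval_taylorExpr`: on the natural
  domain `Ω` of the field it denotes `smoothTaylorMap`, the flow coefficient map of
  `SmoothFieldTaylorCoefficients.lean`; and `smoothTaylorFDeriv_apply_single_eq`: the entries of the
  Jacobian `DΦⱼ(x)` are the values of the derived code lists `pderiv l (taylorExpr F j i)` — so the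
  interval Jacobians `EVⱼ ∋ DΦⱼ(W)`, `AK ∋ DΦ_K(S)` of the `C¹` test are natural interval
  extensions of code lists (`smoothTaylorFDeriv_mem_evalBox`, §2);
* §3 `EVarStepCert n` = an `EStepCert` (field code lists, order `K`, step `h`, initial box `W`,
  a-priori state box `S`, precision parameters) plus the a-priori Jacobian box `VV = [Ṽ]`, with the
  decidable `check` = the state certificate's `EStepCert.check` ∧ every Jacobian code list answers
  ∧ the `C¹` containment `∑_{j<K} [0,h]ʲ·EVⱼ + [0,h]^K·(AK·VV) ⊆ VV` in exact rational interval
  matrix arithmetic (`hoeMatBoxQ`, `imatmulQ`, `matLE` of `VariationalEnclosureCertificate`), and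
  `sound` = `variationalEnclosure_step_intervalTest_smoothOn_local` with EVERY hypothesis
  discharged by the kernel computation: existence of the variational pair on `[0, h]` from every
  `x ∈ W` and, for every solution pair `(z, J)`, `z(t) ∈ S`, the state Taylor tube, `J(t) ∈ VV`
  and `J(t) = ∑_{j<K} tʲ DΦⱼ(x) + t^K N`, `N ∈ AK·VV`; `mem_varEndBox`: `J(h) ∈ J1 :=
  ∑ [h,h]ʲ·EVⱼ + [h,h]^K·(AK·VV)`; `hasFDerivWithinAt_flow_step`: `D_xφ(h, ·)` has entries in `J1`
  on `W` (non-degenerate `S`); `eVarStepVerifier` packages the certificate as a `Verifier`;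
* §4 the mathematical pendulum `x₁' = x₂`, `x₂' = −sin x₁` from `(1, 0)`, order `6`, step `1/8`:
  the state half is VERBATIM the certificate `pendulum` of `ElementaryFieldEnclosureCertificate`
  (`pendulumVar_toE`), the Jacobian box `VV` was found by an untrusted inflate-and-retest search,
  `pendulumVar_check` is accepted by `decide` in the kernel, and the certified Jacobian end box
  puts `D_xφ(1/8, (1,0))` in `([0.9957740, 0.9957754], [0.1248230, 0.1248243]; [−0.0676729,
  −0.0676716], [0.9957596, 0.9957610])` (reference values `0.99577468`, `0.12482366`,
  `−0.06767222`, `0.99576032`).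

Honest limits.  One step, constant a-priori boxes, no rearrangement (`QR`/parallelepiped) of the
Jacobian box — this is the predictor-corrector-free `C¹` HOE step, to be chained by the doubleton
machinery of this directory; the symbolic coefficient code lists grow quickly with the order (the
kernel evaluates them with sharing, the example of order `6` in well under a minute), and
acceptance — never soundness — depends on the precision parameters `cfg`.

## References

* I. Walawska, D. Wilczak, *An implicit algorithm for validated enclosures of the solutions to
  variational equations for ODEs*, Appl. Math. Comput. 291 (2016), §1.1–§2.2 (the `C¹` high-order
  enclosure; Lemma 2). [WalawskaWilczak2016]
* P. Zgliczyński, *C¹-Lohner algorithm*, Found. Comput. Math. 2 (2002), §3. [Zgliczynski2002C1Lohner]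
* R. E. Moore, *Methods and Applications of Interval Analysis*, SIAM 1979: §3.4 (3.13)–(3.19) and
  procedure steps 1–4, §4.3 (4.21), §3.5 (3.31), §8.1 (8.10)–(8.13). [held: lit key
  book:moorend-methods-applications-interval-analysis, pp. 24–27, 42–45, 80–84] [Moore1979]
* E. Hairer, C. Lubich, G. Wanner, *Geometric Numerical Integration*, Springer 2002, §III.5.1
  eqs. (5.3)–(5.8) (Lie derivatives and the Taylor coefficients of the flow). [HairerWannerLubich2002]
* A. Griewank, A. Walther, *Evaluating Derivatives*, 2nd ed., SIAM 2008, §3.1 (forward mode),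
  §13.2 (Taylor coefficient propagation through the elementals). [GriewankWalther2008]
* A. Neumaier, *Interval Methods for Systems of Equations*, Cambridge UP 1990, §3.1
  Proposition 3.1.2 (6)–(7). [Neumaier1991]
* N. S. Nedialkov, K. R. Jackson, J. D. Pryce, Reliable Computing 7 (2001), §3 (HOE existence
  test). [NedialkovJacksonPryce2001]
* N. S. Nedialkov, K. R. Jackson, G. F. Corliss, Appl. Math. Comput. 105 (1999), §5 Algorithm I.
  [NedialkovJacksonCorliss1999]
* R. E. Moore, *Interval Analysis*, Prentice-Hall 1966, Theorem 3.1 (natural interval extension).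
  [Moore1966]
-/

noncomputable section

open Set NonemptyInterval TopologicalSpace
open scoped ContDiff
open Literature.Analysis.ValidatedNumerics Literature.Analysis.ValidatedNumerics.ITaylor

namespace Literature.Analysis.ODE

namespace FExpr

variable {n : ℕ}

/-! ### §1. The code lists of the flow Taylor coefficients and of their Jacobians -/

/-- The code list `t₀ + (t₁ + ⋯ + (t_{n-1} + 0))` of a sum over the state indices.
[cite: Moore1979, §3.4 procedure step 1] -/
def sumE (t : Fin n → FExpr n) : FExpr n :=
  (List.finRange n).foldr (fun l acc => add (t l) acc) (const 0)

/-- [folklore] -/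
private theorem eval_foldr_add (t : Fin n → FExpr n) (x : Fin n → ℝ) (L : List (Fin n)) :
    (L.foldr (fun l acc => add (t l) acc) (const 0)).eval x = (L.map fun l => (t l).eval x).sum := by
  induction L with
  | nil => simp [eval]
  | cons l L ih =>
    rw [List.foldr_cons, List.map_cons, List.sum_cons, ← ih]
    rfl

/-- [folklore] -/
private theorem dom_foldr_add {t : Fin n → FExpr n} {x : Fin n → ℝ} (h : ∀ l, (t l).dom x)
    (L : List (Fin n)) : (L.foldr (fun l acc => add (t l) acc) (const 0)).dom x := by
  induction L with
  | nil => trivial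
  | cons l L ih => exact ⟨h l, ih⟩

/-- The sum code list denotes the sum. [cite: Moore1979, §3.4 procedure step 1] -/
theorem eval_sumE (t : Fin n → FExpr n) (x : Fin n → ℝ) :
    (sumE t).eval x = ∑ l, (t l).eval x := by
  rw [Fin.sum_univ_def]
  exact eval_foldr_add t x _

/-- The sum code list is defined where its terms are. [cite: Moore1979, §3.4 procedure step 1] -/
theorem dom_sumE {t : Fin n → FExpr n} {x : Fin n → ℝ} (h : ∀ l, (t l).dom x) : (sumE t).dom x :=
  dom_foldr_add h _

/-- **The code lists of the flow Taylor coefficient maps**, generated by the Lie–Taylor recursion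
`(Φ₀)ᵢ = Xᵢ`, `(Φ_{j+1})ᵢ = (1/(j+1)) ∑_l f_l · ∂_l (Φⱼ)ᵢ` — Moore's recursive generation of the
Taylor coefficients `(x)_{j+1} = (f(x))_j /(j+1)` ((3.15), (3.17)) carried out SYMBOLICALLY on code
lists with the derived code lists of the partial derivatives ((4.21)); equivalently
`Φⱼ = (1/j!) L_f^j Id` with `L_f g = g'·f` (Hairer–Lubich–Wanner (5.3)–(5.8)).
[cite: Moore1979, §3.4 eqs. (3.15), (3.17)] [cite: HairerWannerLubich2002, §III.5.1 eqs. (5.6), (5.8)]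
[cite: Moore1979, §4.3 eq. (4.21)] -/
def taylorExpr (F : Fin n → FExpr n) : ℕ → Fin n → FExpr n
  | 0, i => var i
  | j + 1, i => smul (1 / ((j : ℚ) + 1)) (sumE fun l => mul (F l) ((taylorExpr F j i).pderiv l))

/-- The coefficient code lists are defined on the natural domain of the field (derived code lists
preserve the domain, `dom_pderiv`). [cite: Moore1979, §3.4 (last paragraph)]
[cite: Moore1979, §4.3 eq. (4.21)] -/
theorem dom_taylorExpr (F : Fin n → FExpr n) {x : Fin n → ℝ} (hx : x ∈ domOpens F) :
    ∀ (j : ℕ) (i : Fin n), (taylorExpr F j i).dom x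
  | 0, _ => trivial
  | j + 1, i => by
    show (sumE fun l => mul (F l) ((taylorExpr F j i).pderiv l)).dom x
    exact dom_sumE fun l => ⟨mem_domOpens.mp hx l, dom_pderiv l _ (dom_taylorExpr F hx j i)⟩

/-- The derivative of the extension by zero of a function on the open set `Ω` that agrees there
with a globally defined one. [folklore] -/
private theorem fderiv_extendZero_eq_of_eqOn {Ω : Opens (Fin n → ℝ)} {g : Ω → ℝ}
    {G : (Fin n → ℝ) → ℝ} (hgG : ∀ (y : Fin n → ℝ) (hy : y ∈ Ω), g ⟨y, hy⟩ = G y)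
    {x : Fin n → ℝ} (hx : x ∈ Ω) : fderiv ℝ (extendZero Ω g) x = fderiv ℝ G x := by
  refine Filter.EventuallyEq.fderiv_eq ?_
  filter_upwards [Ω.isOpen.mem_nhds hx] with y hy
  rw [extendZero_of_mem _ hy, hgG y hy]

/-- **The differential of a code list from its derived code lists** (forward mode: the
Jacobian-vector product is the sum of the coordinate derivatives): on the natural domain,
`f'(x) v = ∑_k v_k · (pderiv k f)(x)`. [cite: GriewankWalther2008, §3.1]
[cite: Moore1979, §4.3 eq. (4.21)] -/
theorem fderiv_apply_eq_sum_pderiv (e : FExpr n) {x : Fin n → ℝ} (hx : e.dom x) (v : Fin n → ℝ) :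
    fderiv ℝ e.eval x v = ∑ k, v k * (e.pderiv k).eval x := by
  have h := (fderiv ℝ e.eval x).toLinearMap.pi_apply_eq_sum_univ v
  simp only [ContinuousLinearMap.coe_coe] at h
  rw [h]
  refine Finset.sum_congr rfl fun k _ => ?_
  have hk : (fun j => if k = j then (1 : ℝ) else 0) = Pi.single k 1 := by
    funext j
    by_cases hkj : k = j
    · subst hkj; simp
    · rw [if_neg hkj, Pi.single_eq_of_ne (Ne.symm hkj)]
  rw [smul_eq_mul, hk, fderiv_eval_single e k hx]

/-- **The coefficient code lists denote the flow Taylor coefficient maps**: on the natural domain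
`Ω` of the field, `⟦taylorExpr F j i⟧(x) = (Φⱼ(x))ᵢ = ((1/j!) L_f^j Xᵢ)(x)` (`smoothTaylorMap` of
`SmoothFieldTaylorCoefficients`).  Induction on `j` by the Lie–Taylor recursion
`Φⱼ'(x) f(x) = (j+1) Φ_{j+1}(x)` (`smoothTaylorFDeriv_apply_field`), the columns of `Φⱼ'` being the
derived code lists (`fderiv_eval_single`) because `⟦taylorExpr F j i⟧` agrees with `(Φⱼ)ᵢ` on the open
set `Ω`. [cite: Moore1979, §3.4 eqs. (3.13), (3.15)] [cite: HairerWannerLubich2002, §III.5.1 eqs. (5.6), (5.8)] -/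
theorem eval_taylorExpr (F : Fin n → FExpr n) :
    ∀ (j : ℕ) (i : Fin n) {x : Fin n → ℝ}, x ∈ domOpens F →
      (taylorExpr F j i).eval x = smoothTaylorMap (contDiffOn_fieldFun F) j x i
  | 0, i, x, _ => by rw [smoothTaylorMap_zero]; rfl
  | j + 1, i, x, hx => by
    -- the smooth side: `Φⱼ'(x) f(x) = (j+1) Φ_{j+1}(x)`, component `i`
    have hrec := congr_fun (smoothTaylorFDeriv_apply_field (contDiffOn_fieldFun F) j hx) i
    simp only [Pi.smul_apply, smul_eq_mul, smoothTaylorFDeriv_apply] at hrec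
    -- `(Φⱼ)ᵢ` agrees with `⟦taylorExpr F j i⟧` on `Ω` (induction hypothesis), so the derivatives agree
    have hfd : fderiv ℝ (extendZero (domOpens F) (flowCoeff (contDiffOn_fieldFun F) j i)) x =
        fderiv ℝ (taylorExpr F j i).eval x :=
      fderiv_extendZero_eq_of_eqOn (fun y hy => by
        have h1 := congr_fun (smoothTaylorMap_of_mem (contDiffOn_fieldFun F) j hy) i
        rw [← h1]
        exact (eval_taylorExpr F j i hy).symm) hx
    rw [hfd, fderiv_apply_eq_sum_pderiv (taylorExpr F j i) (dom_taylorExpr F hx j i)] at hrec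
    -- the code-list side
    have hj : ((j : ℝ) + 1) ≠ 0 := by positivity
    show (((1 / ((j : ℚ) + 1) : ℚ)) : ℝ) *
        (sumE fun l => mul (F l) ((taylorExpr F j i).pderiv l)).eval x = _
    rw [eval_sumE]
    have hsum : ∑ l, (mul (F l) ((taylorExpr F j i).pderiv l)).eval x =
        ∑ k, fieldFun F x k * ((taylorExpr F j i).pderiv k).eval x := rfl
    rw [hsum, hrec]
    push_cast
    field_simp

/-- The flow coefficient `(Φⱼ)ᵢ ∈ C^∞(Ω)` is the interpreted coefficient code list.
[cite: HairerWannerLubich2002, §III.5.1 eq. (5.8)] [cite: Moore1979, §3.4 eq. (3.13)] -/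
theorem flowCoeff_eq_eval_taylorExpr (F : Fin n → FExpr n) (j : ℕ) (i : Fin n)
    {y : Fin n → ℝ} (hy : y ∈ domOpens F) :
    flowCoeff (contDiffOn_fieldFun F) j i ⟨y, hy⟩ = (taylorExpr F j i).eval y := by
  have h1 := congr_fun (smoothTaylorMap_of_mem (contDiffOn_fieldFun F) j hy) i
  rw [← h1, eval_taylorExpr F j i hy]

/-- The flow Taylor coefficient map on `Ω`, as the vector of interpreted code lists.
[cite: Moore1979, §3.4 eqs. (3.13), (3.17)] [cite: HairerWannerLubich2002, §III.5.1 eq. (5.8)] -/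
theorem smoothTaylorMap_eq_eval_taylorExpr (F : Fin n → FExpr n) (j : ℕ) {x : Fin n → ℝ}
    (hx : x ∈ domOpens F) :
    smoothTaylorMap (contDiffOn_fieldFun F) j x = fun i => (taylorExpr F j i).eval x :=
  funext fun i => (eval_taylorExpr F j i hx).symm

/-- **The entries of the Jacobian of the flow Taylor coefficient map are derived code lists**:
`(DΦⱼ(x) e_l)ᵢ = ⟦pderiv l (taylorExpr F j i)⟧(x)` on the natural domain — Moore's (4.21) applied to
the coefficient code lists; the data `EVⱼ`, `AK` of the `C¹` test are therefore natural interval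
extensions of code lists. [cite: Moore1979, §4.3 eq. (4.21)]
[cite: WalawskaWilczak2016, §2.1 (C¹ high-order enclosure)] -/
theorem smoothTaylorFDeriv_apply_single_eq (F : Fin n → FExpr n) (j : ℕ) {x : Fin n → ℝ}
    (hx : x ∈ domOpens F) (i l : Fin n) :
    smoothTaylorFDeriv (contDiffOn_fieldFun F) j x (Pi.single l 1) i =
      ((taylorExpr F j i).pderiv l).eval x := by
  rw [smoothTaylorFDeriv_apply,
    fderiv_extendZero_eq_of_eqOn (fun y hy => flowCoeff_eq_eval_taylorExpr F j i hy) hx,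
    fderiv_eval_single _ l (dom_taylorExpr F hx j i)]

/-- **The Jacobian of a code-list field is the matrix of derived code lists**:
`(f'(x) e_l)ᵢ = ⟦pderiv l fᵢ⟧(x)` on the natural domain (the matrix `DP(y)` of the variational
equation `V' = Df(y) V`). [cite: Moore1979, §4.3 eq. (4.21)] [cite: GriewankWalther2008, §3.1] -/
theorem fderiv_fieldFun_apply_single (F : Fin n → FExpr n) {x : Fin n → ℝ} (hx : x ∈ domOpens F)
    (i l : Fin n) : fderiv ℝ (fieldFun F) x (Pi.single l 1) i = ((F i).pderiv l).eval x := by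
  have hFat : HasFDerivAt (fieldFun F) (fderiv ℝ (fieldFun F) x) x :=
    ((((contDiffOn_fieldFun F).differentiableOn (by simp)) x hx).differentiableAt
      ((domOpens F).isOpen.mem_nhds hx)).hasFDerivAt
  have hcomp : HasFDerivAt (fun y => fieldFun F y i)
      ((ContinuousLinearMap.proj i).comp (fderiv ℝ (fieldFun F) x)) x :=
    hasFDerivAt_pi'.mp hFat i
  have h1 : fderiv ℝ (F i).eval x = (ContinuousLinearMap.proj i).comp (fderiv ℝ (fieldFun F) x) :=
    hcomp.fderiv
  have h2 := fderiv_eval_single (F i) l (mem_domOpens.mp hx i)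
  rw [h1, ContinuousLinearMap.comp_apply, ContinuousLinearMap.proj_apply] at h2
  exact h2

/-! ### §2. Interval Jacobians of the Taylor coefficient maps by natural interval extension -/

/-- **`EVⱼ(i,l) := (pderiv l (taylorExpr F j i))(B) ∋ (DΦⱼ(y) e_l)ᵢ` for all `y ∈ B`**: over a
box inside the natural domain, the natural interval extension of the derived coefficient code list
encloses the Jacobian entry of the flow Taylor coefficient map (the hypotheses `hEV`, `hAK` of
`variationalEnclosure_step_intervalTest_smoothOn_local`, discharged by computation).
[cite: Moore1979, §4.3 eq. (4.21)] [cite: Moore1966, Theorem 3.1]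
[cite: WalawskaWilczak2016, §2.1 (C¹ high-order enclosure)] -/
theorem smoothTaylorFDeriv_mem_evalBox {cfg : SeedCfg} {F : Fin n → FExpr n} {B : Fin n → Iv}
    (hB : boxSet (castBox B) ⊆ domOpens F) {j : ℕ} {i l : Fin n} {D : Iv}
    (hD : evalBox cfg ((taylorExpr F j i).pderiv l) B = some D) {y : Fin n → ℝ}
    (hy : y ∈ boxSet (castBox B)) :
    smoothTaylorFDeriv (contDiffOn_fieldFun F) j y (Pi.single l 1) i ∈ D.ratCast ℝ := by
  rw [smoothTaylorFDeriv_apply_single_eq F j (hB hy) i l]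
  exact (evalBox_sound hD hy).2

/-- The natural interval extension of the coefficient code list itself encloses the flow Taylor
coefficient: `(taylorExpr F j i)(B) ∋ (Φⱼ(y))ᵢ` (an alternative to the order loop `varSeries` for
the state data `Eⱼ`, `V`). [cite: Moore1979, §3.4 eq. (3.17) and procedure step 3]
[cite: Moore1966, Theorem 3.1] -/
theorem smoothTaylorMap_mem_evalBox {cfg : SeedCfg} {F : Fin n → FExpr n} {B : Fin n → Iv}
    (hB : boxSet (castBox B) ⊆ domOpens F) {j : ℕ} {i : Fin n} {I : Iv}
    (hI : evalBox cfg (taylorExpr F j i) B = some I) {y : Fin n → ℝ} (hy : y ∈ boxSet (castBox B)) :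
    smoothTaylorMap (contDiffOn_fieldFun F) j y i ∈ I.ratCast ℝ := by
  rw [← eval_taylorExpr F j i (hB hy)]
  exact (evalBox_sound hI hy).2

/-- All `n × n` entries pass a Boolean test. [folklore] -/
private def allEntries (p : Fin n → Fin n → Bool) : Bool :=
  (List.finRange n).all fun i => (List.finRange n).all fun l => p i l

/-- [folklore] -/
private theorem of_allEntries {p : Fin n → Fin n → Bool} (h : allEntries p = true) (i l : Fin n) :
    p i l = true :=
  List.all_eq_true.1 (List.all_eq_true.1 h i (List.mem_finRange i)) l (List.mem_finRange l)

end FExpr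

open FExpr

variable {n : ℕ}

/-! ### §3. The `C¹` certificate for an elementary field and its soundness -/

/-- A **`C¹` enclosure step certificate for an elementary field**: the code lists of the
components of `f`, the order `K`, the step `h`, the initial box `W`, the claimed a-priori state
enclosure `S ⊇ y([0,h])`, the claimed a-priori Jacobian enclosure `VV = [Ṽ] ⊇ V([0,h])` of the
solution of `V' = Df(y) V`, `V(0) = Id` (the two rough enclosures of Walawska–Wilczak 2016 §2, found
by an untrusted stage), and the precision parameters of the derived program.
[cite: WalawskaWilczak2016, §2 (step structure [x_k],[V_k] ↦ [x_{k+1}],[V_{k+1}]) and §2.1]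
[cite: Moore1979, §8.1 eqs. (8.10), (8.13)] [cite: NedialkovJacksonCorliss1999, §5 Algorithm I] -/
structure EVarStepCert (n : ℕ) where
  /-- The vector field, one code list per component. -/
  field : Fin n → FExpr n
  /-- The order `K ≥ 1` of the Taylor expansions (remainder terms of degree `K`). -/
  order : ℕ
  /-- The step size `h ≥ 0`. -/
  step : ℚ
  /-- The box `W` of initial values. -/
  init : Fin n → Iv
  /-- The claimed a-priori enclosure `S` of the state over the whole step. -/
  apriori : Fin n → Iv
  /-- The claimed a-priori enclosure `VV = [Ṽ]` of the Jacobian `V(t)` over the whole step. -/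
  varApriori : Fin n → Fin n → Iv
  /-- Precision parameters of the derived program. -/
  cfg : SeedCfg

namespace EVarStepCert

variable (c : EVarStepCert n)

/-- The state part of the certificate: the `EStepCert` of `ElementaryFieldEnclosureCertificate`
(coefficient boxes `Eⱼ`, remainder box `V`, state HOE test by the order loop `varSeries`).
[cite: Moore1979, §8.1 eqs. (8.10), (8.13)] -/
def toE : EStepCert n :=
  ⟨c.field, c.order, c.step, c.init, c.apriori, c.cfg⟩

/-- The Jacobian coefficient matrices `EVⱼ(i,l) = (pderiv l (taylorExpr f j i))(W) ∋ (DΦⱼ(x) e_l)ᵢ`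
(`x ∈ W`; junk `0` if the derived program gave up). [cite: WalawskaWilczak2016, §2.1 (C¹ high-order enclosure)]
[cite: Moore1979, §4.3 eq. (4.21)] -/
def varCoeffBox (j : ℕ) (i l : Fin n) : Iv :=
  (evalBox c.cfg ((taylorExpr c.field j i).pderiv l) c.init).getD 0

/-- The Jacobian remainder factor `AK(i,l) = (pderiv l (taylorExpr f K i))(S) ∋ (DΦ_K(z) e_l)ᵢ`
(`z ∈ S`). [cite: WalawskaWilczak2016, §2.1 (C¹ high-order enclosure)] [cite: Moore1979, §4.3 eq. (4.21)] -/
def varRemFactor (i l : Fin n) : Iv :=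
  (evalBox c.cfg ((taylorExpr c.field c.order i).pderiv l) c.apriori).getD 0

/-- The Jacobian remainder matrix `NN = AK · VV` (rational interval matrix product).
[cite: WalawskaWilczak2016, §2.1 (C¹ high-order enclosure)] [cite: Neumaier1991, §3.1 Proposition 3.1.2 (6)] -/
def varRemBox : Fin n → Fin n → Iv :=
  imatmulQ c.varRemFactor c.varApriori

/-- Every Jacobian code list answered: all `EVⱼ` (`j < K`) over `W` and `AK` over `S`.
[cite: Moore1979, §3.4 (last paragraph)] -/
def varRuns : Bool :=
  ((List.range c.order).all fun j => allEntries fun i l =>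
      (evalBox c.cfg ((taylorExpr c.field j i).pderiv l) c.init).isSome) &&
    allEntries fun i l => (evalBox c.cfg ((taylorExpr c.field c.order i).pderiv l) c.apriori).isSome

/-- **The checker**: the state certificate accepts (`EStepCert.check`: `K ≥ 1`, `h ≥ 0`, `W ⊆ S`,
the order loop succeeds over `W` and `S`, `∑_{j<K} [0,h]ʲ·Eⱼ + [0,h]^K·V ⊆ S`), every Jacobian code
list answers, and the `C¹` test `∑_{j<K} [0,h]ʲ·EVⱼ + [0,h]^K·(AK·VV) ⊆ VV` holds in exact rational
interval arithmetic — the two high-order enclosures "checked simultaneously".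
[cite: WalawskaWilczak2016, §2.1 (C¹ high-order enclosure)] [cite: NedialkovJacksonPryce2001, §3 (HOE existence test)]
[cite: Moore1979, §8.1 eq. (8.10) with (8.13)] -/
def check : Bool :=
  c.toE.check && c.varRuns &&
    matLE (hoeMatBoxQ (stepIv c.step) c.varCoeffBox c.varRemBox c.order) c.varApriori

/-- The **Jacobian end box** `J1 = ∑_{j<K} [h,h]ʲ·EVⱼ + [h,h]^K·(AK·VV) ∋ V(h) = D_xφ(h, x)`.
[cite: Zgliczynski2002C1Lohner, §3 (C¹-Lohner algorithm: the enclosure of ∂φ/∂x(h,[x]))]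
[cite: WalawskaWilczak2016, §2 (step structure [x_k],[V_k] ↦ [x_{k+1}],[V_{k+1}])] -/
def varEndBox : Fin n → Fin n → Iv :=
  hoeMatBoxQ (pure c.step) c.varCoeffBox c.varRemBox c.order

variable {c}

/-- What an accepted certificate establishes: the state certificate accepts, `0 < K`, `0 ≤ h`,
the real state HOE test, every Jacobian code list answered with `varCoeffBox`/`varRemFactor` its
answers, and the real `C¹` test `hoeMatBox [0,h] EV (AK·VV) K ≤ VV`.
[cite: WalawskaWilczak2016, §2.1 (C¹ high-order enclosure)] [cite: Moore1979, §8.1 eq. (8.10)] -/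
theorem check_spec (hc : c.check = true) :
    c.toE.check = true ∧ 0 < c.order ∧ (0 : ℝ) ≤ (c.step : ℝ) ∧
      hoeBox ((stepIv c.step).ratCast ℝ) (fun j => castBox (c.toE.coeffBox j))
          (castBox c.toE.remBox) c.order ≤ castBox c.apriori ∧
      (∀ j < c.order, ∀ i l,
        evalBox c.cfg ((taylorExpr c.field j i).pderiv l) c.init = some (c.varCoeffBox j i l)) ∧
      (∀ i l, evalBox c.cfg ((taylorExpr c.field c.order i).pderiv l) c.apriori =
        some (c.varRemFactor i l)) ∧
      hoeMatBox ((stepIv c.step).ratCast ℝ) (fun j => castMat (c.varCoeffBox j))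
          (castMat c.varRemBox) c.order ≤ castMat c.varApriori := by
  simp only [check, Bool.and_eq_true] at hc
  obtain ⟨⟨hE, hruns⟩, hmat⟩ := hc
  obtain ⟨hK, hh, -, -, -, htest⟩ := EStepCert.check_spec hE
  simp only [varRuns, Bool.and_eq_true, List.all_eq_true, List.mem_range] at hruns
  refine ⟨hE, hK, hh, htest, fun j hj i l => ?_, fun i l => ?_, ?_⟩
  · obtain ⟨D, hD⟩ := Option.isSome_iff_exists.mp (of_allEntries (hruns.1 j hj) i l)
    rw [hD, varCoeffBox, hD, Option.getD_some]
  · obtain ⟨D, hD⟩ := Option.isSome_iff_exists.mp (of_allEntries hruns.2 i l)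
    rw [hD, varRemFactor, hD, Option.getD_some]
  · have h := castMat_mono (le_of_matLE hmat)
    rw [castMat_hoeMatBoxQ] at h
    exact h

/-- The Jacobian coefficient matrices enclose the Jacobians of the flow Taylor coefficient maps on
`W` (`j < K`). [cite: WalawskaWilczak2016, §2.1 (C¹ high-order enclosure)] [cite: Moore1979, §4.3 eq. (4.21)] -/
theorem varCoeffBox_mem (hc : c.check = true) {j : ℕ} (hj : j < c.order) {y : Fin n → ℝ}
    (hy : y ∈ boxSet (castBox c.init)) (i l : Fin n) :
    smoothTaylorFDeriv (contDiffOn_fieldFun c.field) j y (Pi.single l 1) i ∈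
      castMat (c.varCoeffBox j) i l := by
  obtain ⟨hE, -, -, -, hEV, -, -⟩ := check_spec hc
  rw [castMat_apply]
  exact smoothTaylorFDeriv_mem_evalBox (EStepCert.init_subset_dom hE) (hEV j hj i l) hy

/-- The Jacobian remainder factor encloses `DΦ_K` on `S`. [cite: WalawskaWilczak2016, §2.1 (C¹ high-order enclosure)]
[cite: Moore1979, §4.3 eq. (4.21)] -/
theorem varRemFactor_mem (hc : c.check = true) {z : Fin n → ℝ}
    (hz : z ∈ boxSet (castBox c.apriori)) (i l : Fin n) :
    smoothTaylorFDeriv (contDiffOn_fieldFun c.field) c.order z (Pi.single l 1) i ∈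
      castMat c.varRemFactor i l := by
  obtain ⟨hE, -, -, -, -, hAK, -⟩ := check_spec hc
  rw [castMat_apply]
  exact smoothTaylorFDeriv_mem_evalBox (EStepCert.apriori_subset_dom hE) (hAK i l) hz

/-- **Soundness of the `C¹` step certificate for an elementary field** (Walawska–Wilczak 2016
§2.1 / §2.2 Lemma 2; Zgliczyński 2002; for fields smooth only on their natural domain).  If `check`
accepts, then for every real initial value `x` in the box `W`: the variational system `y' = f(y)`,
`V' = Df(y) ∘ V`, `y(0) = x`, `V(0) = Id` has a solution on `[0, h]`, and EVERY solution pair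
`(z, J)` satisfies for all `t ∈ [0, h]`: `z t ∈ S`, `z t = ∑_{j<K} tʲ Φⱼ(x) + t^K v` with `v` in the
state remainder box, `J t ∈ VV` and `J t = ∑_{j<K} tʲ DΦⱼ(x) + t^K N` with `N ∈ AK·VV`, entrywise —
`variationalEnclosure_step_intervalTest_smoothOn_local` with every box hypothesis discharged by the
kernel computation (`Φⱼ = smoothTaylorMap`, `DΦⱼ = smoothTaylorFDeriv`; on `Ω` these are the
interpreted code lists, `smoothTaylorMap_eq_eval_taylorExpr`, `smoothTaylorFDeriv_apply_single_eq`).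
[cite: WalawskaWilczak2016, §2.1 (C¹ high-order enclosure) and §2.2 Lemma 2]
[cite: Zgliczynski2002C1Lohner, §3 (C¹-Lohner algorithm: the enclosure of ∂φ/∂x(h,[x]))]
[cite: Moore1979, §8.1 eqs. (8.10), (8.13)] -/
theorem sound (hc : c.check = true) {x : Fin n → ℝ} (hx : x ∈ boxSet (castBox c.init)) :
    (∃ y : ℝ → Fin n → ℝ, ∃ V' : ℝ → (Fin n → ℝ) →L[ℝ] (Fin n → ℝ), y 0 = x ∧ V' 0 = 1 ∧
      (∀ t ∈ Icc 0 (c.step : ℝ),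
        HasDerivWithinAt y (fieldFun c.field (y t)) (Icc 0 (c.step : ℝ)) t) ∧
      ∀ t ∈ Icc 0 (c.step : ℝ),
        HasDerivWithinAt V' ((fderiv ℝ (fieldFun c.field) (y t)).comp (V' t))
          (Icc 0 (c.step : ℝ)) t) ∧
    ∀ (z : ℝ → Fin n → ℝ) (J : ℝ → (Fin n → ℝ) →L[ℝ] (Fin n → ℝ)), z 0 = x → J 0 = 1 →
      (∀ t ∈ Icc 0 (c.step : ℝ),
        HasDerivWithinAt z (fieldFun c.field (z t)) (Icc 0 (c.step : ℝ)) t) →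
      (∀ t ∈ Icc 0 (c.step : ℝ),
        HasDerivWithinAt J ((fderiv ℝ (fieldFun c.field) (z t)).comp (J t))
          (Icc 0 (c.step : ℝ)) t) →
      ∀ t ∈ Icc 0 (c.step : ℝ),
        (z t ∈ boxSet (castBox c.apriori) ∧ ∃ v ∈ boxSet (castBox c.toE.remBox),
          z t = (∑ j ∈ Finset.range c.order,
            t ^ j • smoothTaylorMap (contDiffOn_fieldFun c.field) j x) + t ^ c.order • v) ∧
        (∀ i l, J t (Pi.single l 1) i ∈ castMat c.varApriori i l) ∧
        ∃ N : (Fin n → ℝ) →L[ℝ] (Fin n → ℝ),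
          (∀ i l, N (Pi.single l 1) i ∈ castMat c.varRemBox i l) ∧
          J t = (∑ j ∈ Finset.range c.order,
              t ^ j • smoothTaylorFDeriv (contDiffOn_fieldFun c.field) j x) + t ^ c.order • N := by
  obtain ⟨hE, hK, hh, htest, -, -, htestV⟩ := check_spec hc
  exact variationalEnclosure_step_intervalTest_smoothOn_local (contDiffOn_fieldFun c.field) hK hh
    (fun t ht => mem_ratCast_stepIv ht) (castBox c.init) (castBox c.apriori) (castBox c.toE.remBox)
    (fun j => castBox (c.toE.coeffBox j)) (fun j => castMat (c.varCoeffBox j))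
    (castMat c.varRemFactor) (castMat c.varApriori) (castMat c.varRemBox)
    (EStepCert.apriori_subset_dom hE) (fun j hj => EStepCert.mapsTo_coeffBox hE hj)
    (EStepCert.mapsTo_remBox hE) htest (fun j hj y hy i l => varCoeffBox_mem hc hj hy i l)
    (fun z hz i l => varRemFactor_mem hc hz i l) (castMat_imatmulQ _ _).symm.le htestV hx

/-- Every solution from `W` stays in the natural domain of the field over the step (the state half
is an accepted `EStepCert`). [cite: Moore1979, §8.1 eq. (8.13)] -/
theorem mem_dom (hc : c.check = true) {x : Fin n → ℝ} (hx : x ∈ boxSet (castBox c.init))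
    {z : ℝ → Fin n → ℝ} (hz0 : z 0 = x)
    (hz : ∀ t ∈ Icc 0 (c.step : ℝ),
      HasDerivWithinAt z (fieldFun c.field (z t)) (Icc 0 (c.step : ℝ)) t)
    {t : ℝ} (ht : t ∈ Icc 0 (c.step : ℝ)) : z t ∈ domOpens c.field :=
  mem_domOpens.mpr (EStepCert.mem_dom (check_spec hc).1 hx hz0 hz ht)

/-- **The certified state end box**: every solution from `x ∈ W` satisfies `z(h) ∈ toE.endBox`.
[cite: Moore1979, §8.1 eq. (8.10)] [cite: NedialkovJacksonCorliss1999, §5 Algorithm I] -/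
theorem mem_endBox (hc : c.check = true) {x : Fin n → ℝ} (hx : x ∈ boxSet (castBox c.init))
    {z : ℝ → Fin n → ℝ} (hz0 : z 0 = x)
    (hz : ∀ t ∈ Icc 0 (c.step : ℝ),
      HasDerivWithinAt z (fieldFun c.field (z t)) (Icc 0 (c.step : ℝ)) t) :
    z c.step ∈ boxSet (castBox c.toE.endBox) :=
  EStepCert.mem_endBox (check_spec hc).1 hx hz0 hz

/-- `castMat varEndBox` is the real matrix HOE box at the point interval `[h, h]`.
[cite: WalawskaWilczak2016, §2 (step structure [x_k],[V_k] ↦ [x_{k+1}],[V_{k+1}])] -/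
theorem castMat_varEndBox :
    castMat c.varEndBox =
      hoeMatBox (pure (c.step : ℝ)) (fun j => castMat (c.varCoeffBox j)) (castMat c.varRemBox)
        c.order := by
  rw [varEndBox, castMat_hoeMatBoxQ, ratCast_pure]

/-- **The certified Jacobian end box**: if `check` accepts, every solution pair `(z, J)` from
`(x, Id)`, `x ∈ W`, satisfies `J(h) ∈ varEndBox` entrywise — the interval matrix
`J1 ∋ V(h) = D_xφ(h, x)` of the `C¹`-Lohner algorithm, from the Taylor representation of `J(h)`
given by `sound` and the inclusion property of the interval polynomial.
[cite: Zgliczynski2002C1Lohner, §3 (C¹-Lohner algorithm: the enclosure of ∂φ/∂x(h,[x]))]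
[cite: Moore1979, §3.3 Theorem 3.1 and §3.5 eq. (3.31)] -/
theorem mem_varEndBox (hc : c.check = true) {x : Fin n → ℝ} (hx : x ∈ boxSet (castBox c.init))
    {z : ℝ → Fin n → ℝ} {J : ℝ → (Fin n → ℝ) →L[ℝ] (Fin n → ℝ)} (hz0 : z 0 = x) (hJ0 : J 0 = 1)
    (hz : ∀ t ∈ Icc 0 (c.step : ℝ),
      HasDerivWithinAt z (fieldFun c.field (z t)) (Icc 0 (c.step : ℝ)) t)
    (hJ : ∀ t ∈ Icc 0 (c.step : ℝ),
      HasDerivWithinAt J ((fderiv ℝ (fieldFun c.field) (z t)).comp (J t))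
        (Icc 0 (c.step : ℝ)) t) :
    ∀ i l, J c.step (Pi.single l 1) i ∈ castMat c.varEndBox i l := by
  obtain ⟨-, -, hh, -, -, -, -⟩ := check_spec hc
  obtain ⟨-, henc⟩ := sound hc hx
  obtain ⟨-, -, N, hN, hJt⟩ := henc z J hz0 hJ0 hz hJ (c.step : ℝ) ⟨hh, le_rfl⟩
  have hmem := jacTaylorSum_mem_hoeMatBox (EV := fun j => castMat (c.varCoeffBox j))
    (NN := castMat c.varRemBox) (K := c.order) (mem_pure_self (c.step : ℝ))
    (e := fun j => fun i l =>
      smoothTaylorFDeriv (contDiffOn_fieldFun c.field) j x (Pi.single l 1) i)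
    (fun j hj => (mem_matBoxSet_iff (A := castMat (c.varCoeffBox j))).2 fun i l =>
      varCoeffBox_mem hc hj hx i l)
    ((mem_matBoxSet_iff (A := castMat c.varRemBox)).2 hN)
  have key : (fun i l => J (c.step : ℝ) (Pi.single l 1) i) =
      (∑ k ∈ Finset.range c.order, (c.step : ℝ) ^ k • fun i l =>
        smoothTaylorFDeriv (contDiffOn_fieldFun c.field) k x (Pi.single l 1) i) +
        (c.step : ℝ) ^ c.order • fun i l => N (Pi.single l 1) i := by
    rw [hJt]
    ext i l
    simp only [_root_.add_apply, _root_.sum_apply, _root_.smul_apply, Finset.sum_apply,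
      Pi.smul_apply, Pi.add_apply, smul_eq_mul]
  rw [← key, ← castMat_varEndBox] at hmem
  exact (mem_matBoxSet_iff (A := castMat c.varEndBox)).1 hmem

/-- **The derivative of the flow from an accepted certificate** (Walawska–Wilczak 2016 §1.2
`ψ(t,x,Id) = D_xφ(t,x)`; Zgliczyński 2002).  If `check` accepts and the a-priori box `S` is
non-degenerate (`posBox`), then for ANY family `u` of solutions of `y' = f(y)` on `[0, h]` from the
points of `W` staying in `S`, every `x ∈ W` and `τ ∈ [0, h]`: the flow map `x' ↦ u x' τ` has within
the box `W` at `x` a derivative `J` with entries in `VV` and in `∑_{j<K} [τ,τ]ʲ·EVⱼ + [τ,τ]^K·(AK·VV)`,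
`J = ∑_{j<K} τʲ DΦⱼ(x) + τ^K N`, `N ∈ AK·VV`.
[cite: WalawskaWilczak2016, §1.2 (ψ = D_xφ·V) and §2.2 Lemma 2]
[cite: Zgliczynski2002C1Lohner, §3 (C¹-Lohner algorithm: the enclosure of ∂φ/∂x(h,[x]))] -/
theorem hasFDerivWithinAt_flow (hc : c.check = true) (hS : posBox c.apriori = true)
    {u : (Fin n → ℝ) → ℝ → Fin n → ℝ}
    (hu : IsSolutionFamily (fieldFun c.field) (boxSet (castBox c.apriori))
      (boxSet (castBox c.init)) (c.step : ℝ) u)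
    {x : Fin n → ℝ} (hx : x ∈ boxSet (castBox c.init)) {τ : ℝ} (hτ : τ ∈ Icc 0 (c.step : ℝ)) :
    ∃ J : (Fin n → ℝ) →L[ℝ] (Fin n → ℝ),
      HasFDerivWithinAt (fun x' => u x' τ) J (boxSet (castBox c.init)) x ∧
      (∀ i l, J (Pi.single l 1) i ∈ castMat c.varApriori i l) ∧
      (∀ i l, J (Pi.single l 1) i ∈
        hoeMatBox (pure τ) (fun j => castMat (c.varCoeffBox j)) (castMat c.varRemBox) c.order i l) ∧
      ∃ N : (Fin n → ℝ) →L[ℝ] (Fin n → ℝ),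
        (∀ i l, N (Pi.single l 1) i ∈ castMat c.varRemBox i l) ∧
        J = (∑ j ∈ Finset.range c.order,
            τ ^ j • smoothTaylorFDeriv (contDiffOn_fieldFun c.field) j x) + τ ^ c.order • N := by
  obtain ⟨hE, hK, hh, htest, -, -, htestV⟩ := check_spec hc
  exact hasFDerivWithinAt_flow_intervalTest_smoothOn_local (contDiffOn_fieldFun c.field) hK hh
    (fun t ht => mem_ratCast_stepIv ht) (castBox c.init) (castBox c.apriori) (castBox c.toE.remBox)
    (fun j => castBox (c.toE.coeffBox j)) (fun j => castMat (c.varCoeffBox j))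
    (castMat c.varRemFactor) (castMat c.varApriori) (castMat c.varRemBox)
    (EStepCert.apriori_subset_dom hE) (uniqueDiffOn_of_posBox hS)
    (fun j hj => EStepCert.mapsTo_coeffBox hE hj) (EStepCert.mapsTo_remBox hE) htest
    (fun j hj y hy i l => varCoeffBox_mem hc hj hy i l) (fun z hz i l => varRemFactor_mem hc hz i l)
    (castMat_imatmulQ _ _).symm.le htestV hu hx hτ (T' := pure τ) (mem_pure_self τ)

/-- **`D_xφ(h, [W]) ⊆ J1`**: under `check` and `posBox S`, for any family of solutions from `W`
staying in `S`, the flow map at time `h` has within the box `W` at every `x ∈ W` a derivative with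
entries in `varEndBox`. [cite: Zgliczynski2002C1Lohner, §3 (C¹-Lohner algorithm: the enclosure of ∂φ/∂x(h,[x]))]
[cite: WalawskaWilczak2016, §2.2 Lemma 2] -/
theorem hasFDerivWithinAt_flow_step (hc : c.check = true) (hS : posBox c.apriori = true)
    {u : (Fin n → ℝ) → ℝ → Fin n → ℝ}
    (hu : IsSolutionFamily (fieldFun c.field) (boxSet (castBox c.apriori))
      (boxSet (castBox c.init)) (c.step : ℝ) u)
    {x : Fin n → ℝ} (hx : x ∈ boxSet (castBox c.init)) :
    ∃ J : (Fin n → ℝ) →L[ℝ] (Fin n → ℝ),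
      HasFDerivWithinAt (fun x' => u x' c.step) J (boxSet (castBox c.init)) x ∧
      ∀ i l, J (Pi.single l 1) i ∈ castMat c.varEndBox i l := by
  obtain ⟨-, -, hh, -, -, -, -⟩ := check_spec hc
  obtain ⟨J, hJ, -, hJ1, -⟩ := hasFDerivWithinAt_flow hc hS hu hx (τ := (c.step : ℝ)) ⟨hh, le_rfl⟩
  refine ⟨J, hJ, ?_⟩
  rw [castMat_varEndBox]
  exact hJ1

end EVarStepCert

/-! ### The certificate as a `Verifier` -/

section VerifierPackaging

/-- A **`C¹` step instance for an elementary field**: the data fixed in advance (field code lists,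
precision parameters, order, step, initial box); the pair of a-priori boxes `(S, VV)` is the
certificate searched for by an untrusted stage. [cite: WalawskaWilczak2016, §2.1 (C¹ high-order enclosure)]
[cite: NedialkovJacksonCorliss1999, §5 Algorithm I] -/
structure EVarInstance (n : ℕ) where
  /-- The vector field, one code list per component. -/
  field : Fin n → FExpr n
  /-- Precision parameters of the derived program. -/
  cfg : SeedCfg
  /-- The order `K`. -/
  order : ℕ
  /-- The step size `h`. -/
  step : ℚ
  /-- The initial box `W`. -/
  init : Fin n → Iv

/-- The claim certified for an instance: existence of the variational pair `(y, V)`, `y' = f(y)`,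
`V' = Df(y) ∘ V`, `y(0) = x`, `V(0) = Id` on `[0, h]` from every `x ∈ W`.
[cite: WalawskaWilczak2016, §2.2 Lemma 2] -/
def EVarInstance.Claim (I : EVarInstance n) : Prop :=
  ∀ x ∈ boxSet (castBox I.init), ∃ y : ℝ → Fin n → ℝ, ∃ V' : ℝ → (Fin n → ℝ) →L[ℝ] (Fin n → ℝ),
    y 0 = x ∧ V' 0 = 1 ∧
    (∀ t ∈ Icc 0 (I.step : ℝ),
      HasDerivWithinAt y (fieldFun I.field (y t)) (Icc 0 (I.step : ℝ)) t) ∧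
    ∀ t ∈ Icc 0 (I.step : ℝ),
      HasDerivWithinAt V' ((fderiv ℝ (fieldFun I.field) (y t)).comp (V' t)) (Icc 0 (I.step : ℝ)) t

/-- The instance together with candidate a-priori boxes, as a certificate.
[cite: NedialkovJacksonCorliss1999, §5 Algorithm I] -/
def EVarInstance.withBoxes (I : EVarInstance n) (S : Fin n → Iv) (VV : Fin n → Fin n → Iv) :
    EVarStepCert n :=
  ⟨I.field, I.order, I.step, I.init, S, VV, I.cfg⟩

/-- **The `C¹` step verifier for elementary fields** in the sense of `ValidatedNumerics.Verifier`:
certificates are pairs of a-priori boxes `(S, VV)`, the checker is `EVarStepCert.check`, soundness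
is `EVarStepCert.sound`. [cite: WalawskaWilczak2016, §2.1 (C¹ high-order enclosure) and §2.2 Lemma 2] -/
def eVarStepVerifier (n : ℕ) : Verifier (EVarInstance n) EVarInstance.Claim where
  Cert := (Fin n → Iv) × (Fin n → Fin n → Iv)
  check I SV := (I.withBoxes SV.1 SV.2).check
  sound I SV h := fun _ hx => (EVarStepCert.sound (c := I.withBoxes SV.1 SV.2) h hx).1

end VerifierPackaging

/-! ### §4. Kernel example: the `C¹` step of the pendulum -/

section PendulumExample

/-- **The `C¹` step for the pendulum** `x₁' = x₂`, `x₂' = −sin x₁` from the point `(1, 0)`: order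
`6`, step `h = 1/8`, a-priori state box `S = [0.98, 1.001] × [−0.11, 0.001]` and precision
parameters exactly as the state certificate `pendulum` of `ElementaryFieldEnclosureCertificate`,
and the a-priori Jacobian box `VV = ([0.9952, 1.0006], [−0.0128, 0.1377]; [−0.0746, 0.0069],
[0.9951, 1.0006])` (row-wise) found by the untrusted inflate-and-retest stage.
[cite: WalawskaWilczak2016, §2.1 (C¹ high-order enclosure)] [cite: Moore1979, §8.1 eqs. (8.10), (8.13)] -/
def pendulumVar : EVarStepCert 2 where
  field := pendulumField
  order := 6
  step := 1 / 8
  init := ![pure 1, pure 0]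
  apriori := ![⟨(98 / 100, 1001 / 1000), by decide +kernel⟩,
    ⟨(-11 / 100, 1 / 1000), by decide +kernel⟩]
  varApriori :=
    ![![⟨(9952 / 10000, 10006 / 10000), by decide +kernel⟩,
        ⟨(-128 / 10000, 1377 / 10000), by decide +kernel⟩],
      ![⟨(-746 / 10000, 69 / 10000), by decide +kernel⟩,
        ⟨(9951 / 10000, 10006 / 10000), by decide +kernel⟩]]
  cfg := ⟨40, 30, 12, 3, 0⟩

/-- The state half of the `C¹` certificate is verbatim the accepted state certificate `pendulum`.
[cite: Moore1979, §8.1 eqs. (8.10), (8.13)] -/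
theorem pendulumVar_toE : pendulumVar.toE = pendulum := rfl

set_option maxHeartbeats 0 in -- kernel evaluation of the order-6 symbolic Jacobians, ≈ 1 min
/-- The kernel accepts the `C¹` certificate: the state HOE test and the variational HOE test both
hold in rounded rational interval arithmetic. [cite: WalawskaWilczak2016, §2.1 (C¹ high-order enclosure)]
[cite: Moore1979, §8.1 eq. (8.10)] -/
theorem pendulumVar_check : pendulumVar.check = true := by
  decide +kernel

/-- The a-priori state box is non-degenerate. [cite: Neumaier1991, §3.1 (int A)] -/
theorem pendulumVar_posBox : posBox pendulumVar.apriori = true := by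
  decide +kernel

set_option maxHeartbeats 0 in -- kernel evaluation of the order-6 symbolic Jacobians, ≈ 1 min
/-- The certified Jacobian end box is contained in `([0.9957740, 0.9957754], [0.1248230, 0.1248243];
[−0.0676729, −0.0676716], [0.9957596, 0.9957610])` (kernel computation; row-wise; reference values
of `D_xφ(1/8, (1,0))`: `0.99577468`, `0.12482366`, `−0.06767222`, `0.99576032`).
[cite: Zgliczynski2002C1Lohner, §3 (C¹-Lohner algorithm: the enclosure of ∂φ/∂x(h,[x]))] -/
theorem pendulumVar_varEndBox_le :
    matLE pendulumVar.varEndBox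
      ![![⟨(9957740 / 10000000, 9957754 / 10000000), by decide +kernel⟩,
          ⟨(1248230 / 10000000, 1248243 / 10000000), by decide +kernel⟩],
        ![⟨(-676729 / 10000000, -676716 / 10000000), by decide +kernel⟩,
          ⟨(9957596 / 10000000, 9957610 / 10000000), by decide +kernel⟩]] = true := by
  decide +kernel

/-- **Existence of the variational pair, certified by the kernel**: the pendulum with
`x(0) = (1, 0)` together with its variational equation `V' = Df(x(t)) V`, `V(0) = Id` has a solution
on `[0, 1/8]`. [cite: WalawskaWilczak2016, §2.2 Lemma 2] [cite: Moore1979, §8.1 eqs. (8.10), (8.13)] -/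
theorem pendulumVar_exists :
    ∃ y : ℝ → Fin 2 → ℝ, ∃ V' : ℝ → (Fin 2 → ℝ) →L[ℝ] (Fin 2 → ℝ), y 0 = ![1, 0] ∧ V' 0 = 1 ∧
      (∀ t ∈ Icc (0 : ℝ) (((1 / 8 : ℚ) : ℝ)),
        HasDerivWithinAt y (fieldFun pendulumField (y t)) (Icc (0 : ℝ) ((1 / 8 : ℚ) : ℝ)) t) ∧
      ∀ t ∈ Icc (0 : ℝ) (((1 / 8 : ℚ) : ℝ)),
        HasDerivWithinAt V' ((fderiv ℝ (fieldFun pendulumField) (y t)).comp (V' t))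
          (Icc (0 : ℝ) ((1 / 8 : ℚ) : ℝ)) t :=
  (EVarStepCert.sound pendulumVar_check pendulum_init_mem).1

/-- **Enclosure of the Jacobian, certified by the kernel**: for every solution pair `(z, J)` of the
pendulum and its variational equation from `((1, 0), Id)` on `[0, 1/8]`, `J(t)` stays in the
a-priori box `VV` and `J(1/8) = D_xφ(1/8, (1,0))` lies in the certified Jacobian end box, in
particular (row-wise) in `([0.9957740, 0.9957754], [0.1248230, 0.1248243]; [−0.0676729, −0.0676716],
[0.9957596, 0.9957610])`. [cite: Zgliczynski2002C1Lohner, §3 (C¹-Lohner algorithm: the enclosure of ∂φ/∂x(h,[x]))]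
[cite: WalawskaWilczak2016, §2.1 (C¹ high-order enclosure) and §2.2 Lemma 2] -/
theorem pendulumVar_jacobian {z : ℝ → Fin 2 → ℝ} {J : ℝ → (Fin 2 → ℝ) →L[ℝ] (Fin 2 → ℝ)}
    (hz0 : z 0 = ![1, 0]) (hJ0 : J 0 = 1)
    (hz : ∀ t ∈ Icc (0 : ℝ) (((1 / 8 : ℚ) : ℝ)),
      HasDerivWithinAt z (fieldFun pendulumField (z t)) (Icc (0 : ℝ) ((1 / 8 : ℚ) : ℝ)) t)
    (hJ : ∀ t ∈ Icc (0 : ℝ) (((1 / 8 : ℚ) : ℝ)),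
      HasDerivWithinAt J ((fderiv ℝ (fieldFun pendulumField) (z t)).comp (J t))
        (Icc (0 : ℝ) ((1 / 8 : ℚ) : ℝ)) t) :
    (∀ t ∈ Icc (0 : ℝ) (((1 / 8 : ℚ) : ℝ)), ∀ i l,
        J t (Pi.single l 1) i ∈ castMat pendulumVar.varApriori i l) ∧
      ∀ i l, J ((1 / 8 : ℚ) : ℝ) (Pi.single l 1) i ∈ castMat pendulumVar.varEndBox i l :=
  ⟨fun t ht => ((EVarStepCert.sound pendulumVar_check pendulum_init_mem).2 z J hz0 hJ0 hz hJ t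
      ht).2.1,
    EVarStepCert.mem_varEndBox pendulumVar_check pendulum_init_mem hz0 hJ0 hz hJ⟩

/-- **The Jacobian of the pendulum field as derived code lists**: on all of `ℝ²` (the natural
domain of `pendulumField`), `Df(x) e_l` has components `⟦pderiv l fᵢ⟧(x)`, i.e.
`Df(x) = (0, 1; −cos x₁, 0)`. [cite: Moore1979, §4.3 eq. (4.21)] -/
theorem pendulum_fderiv_apply_single (x : Fin 2 → ℝ) (i l : Fin 2) :
    fderiv ℝ (fieldFun pendulumField) x (Pi.single l 1) i =
      (![![0, 1], ![-Real.cos (x 0), 0]] : Fin 2 → Fin 2 → ℝ) i l := by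
  have hx : x ∈ domOpens pendulumField := mem_domOpens.mpr fun i => by
    fin_cases i <;> exact trivial
  rw [fderiv_fieldFun_apply_single pendulumField hx i l]
  fin_cases i <;> fin_cases l
  · show (((if (1 : Fin 2) = 0 then 1 else 0 : ℚ)) : ℝ) = 0
    simp
  · show (((if (1 : Fin 2) = 1 then 1 else 0 : ℚ)) : ℝ) = 1
    simp
  · show -(Real.cos (x 0) * (((if (0 : Fin 2) = 0 then 1 else 0 : ℚ)) : ℝ)) = -Real.cos (x 0)
    simp
  · show -(Real.cos (x 0) * (((if (0 : Fin 2) = 1 then 1 else 0 : ℚ)) : ℝ)) = 0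
    simp

end PendulumExample

end Literature.Analysis.ODE
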